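import Literature.Geometry.Lorentzian.BlackHoles
import Literature.Geometry.Lorentzian.KerrTimeDerivative
import Mathlib.Analysis.SpecialFunctions.ImproperIntegrals
import HarnessLib

/-!
# Barrier catalogue `FinalStateConjecture`: Price-law tails — generic linear waves on sub-extremal Kerr decay exactly like `t⁻³`, never exponentially
(`Literature/Barriers/FinalStateConjecture/`, D-0021; family `gr`, summit `FinalStateConjecture`;
namespace `Literature.Barriers.FinalStateConjecture`)

This file vendors, as a **named fact** (D-0014), the late-time asymptotics ("Price's law with
leading-order term") for the scalar wave equation `□_g ψ = 0` on Schwarzschild and sub-extremal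
Kerr exteriors: solutions arising from smooth compactly supported data satisfy, at every fixed
spatial position, `ψ = c t⁻³ + O(t^{−3−ε})` with ONE constant `c` computable from the data and
non-zero for generic data — Angelopoulos–Aretakis–Gajic, Adv. Math. 323 (2018), Thm. 1.1
(spherically symmetric stationary backgrounds including Schwarzschild, `c = −8 I₀⁽¹⁾[ψ]`, the
"time-inverted Newman–Penrose constant"), and Hintz, Comm. Math. Phys. 389 (2022), Thms. 1.1–1.2
(Schwarzschild and the full sub-extremal Kerr family; "The constant `c` in Theorem 1.2 only
vanishes on a codimension 1 subspace of initial data", p. 3). As a barrier it records that decay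
to the final state for `Λ = 0` is at best inverse-polynomial already for the linear scalar model,
in contrast with the exponential decay `g − g_b = O(e^{−α t_*})` underlying the nonlinear
stability of Kerr–de Sitter (Hintz–Vasy, Acta Math. 220 (2018), Thm. 1.1): "The merely polynomial
decay rates on asymptotically flat (`Λ = 0`) as compared to the exponential decay rate on
asymptotically hyperbolic (`Λ > 0`) spacetimes is a low frequency effect, related to the very
delicate behavior of the resolvent near zero energy on asymptotically flat spaces" (ibid., §1.1,
p. 12); "despite the fact that, formally, the Einstein vacuum equation is the limit of [the
`Λ > 0` equation] as `Λ → 0`, the global behavior of the corresponding solutions is radically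
different" (Klainerman, C. R. Mécanique 353 (2025), §3.5.1).

* `Kerr.atTime` — the point of the Kerr–Schild chart with time `t* = τ` on the `∂_{t*}`-line
  through a given point (helper, with `Kerr.radius_ofTimeSpace_spatial`).
* `PriceLawTail` — **the barrier declaration** (structured block in its docstring).
* `PriceLawTail.exists_lower_bound` — corollary: an admissible wave with `|ψ| ≥ c τ⁻³` at late
  times along a `∂_{t*}`-line, `c > 0`.
* **Barrier audit 2026-08-15 (D-0021), appended section at the end of the file** —
  `PriceLawTail.exists_abs_le_div_cube`, `PriceLawTail.integrableOn_line` (under the fact every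
  admissible wave is `O(τ⁻³)` on `[1, ∞)` and Lebesgue-integrable in time on `[0, ∞)` along every
  `∂_{t*}`-line: the tail is an INTEGRABLE rate), `PriceLawTail.narrow` (**the narrowed form of the
  barrier, a theorem under `PriceLawTail`**: the two-sided `τ⁻³` window, with the corrected
  `technique_class` / `evasions_known` / `scope_caveats` block — four of the nine technique tags of
  `PriceLawTail` are not covered by the cited theorems; at review (2026-08-15, D-0026/D-0027) the
  audit's separate named fact `PriceLawTailNarrow`, a weaker restatement of `PriceLawTail` proved
  from it in one line, was merged back into this theorem — the section introduces no named fact),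
  `not_forall_rate_of_exists_lower_bound`, `PriceLawTail.not_forall_rate`,
  `PriceLawTail.not_forall_exp_rate`, `PriceLawTail.not_forall_rpow_rate` (the formal `blocks`
  content: no rate `ρ` with `τ³ρ → 0`, in particular no `e^{−ατ}` and no `τ^{−3−ε}`, bounds all
  admissible waves).

## Rendering on the prelude (conventions of `BlackHoles.lean`, gr.S24)

* *Solutions.* The prelude class `Literature.GR.IsAdmissibleKerrWave M a ψ`: `ψ` real, globally `C^∞` on
  the open Kerr–Schild exterior chart `Kerr.exterior M a = {r > r₊}`, `□_{g_{M,a}} ψ = 0` for the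
  `C^∞` Kerr metric `Kerr.smoothMetric M a r₊` (instances `[Kerr.Facts] [Kerr.SliceFacts]`), Cauchy
  data compactly supported in the open leaf `{t* = 0} ∩ {r > r₊}`. The printed classes are: smooth
  compactly supported data on AAG's hypersurface `Σ₀` (spacelike for `r ≤ R`, outgoing null for
  `r ≥ R`; AAG §2.2) resp. `φ₀, φ₁ ∈ C_c^∞(X°)` on Hintz's `{t_* = 0}`,
  `X° = [m, ∞)_r × S²` cut INSIDE the hole (Thm. 1.2; in the body Thm. 4.5, stated in forcing
  form `□φ = f`, `f ∈ C_c^∞((0, ∞)_{t_*}; 𝒜̄^{4+α}(X))`, `φ` the unique forward solution,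
  `c = c(f)`, the initial value problem being reduced to it "precisely as in Corollary 3.11"), or
  on the Boyer–Lindquist slice `{t = 0}` with support away from the horizon (Thm. 1.1; Cor. 4.7).
  These classes are NOT the same, and only the two one-sided inclusions actually used are claimed.
  Notation: `v := t* + r` is the advanced time of the ingoing chart, constant along the integral
  lines of the future-directed ingoing principal null field `−ℓ♯ = ∂_{t*} − ℓ⃗·∂_y` (along which
  `dr/dt* = −ℓ⃗·∇r = −1`); on the closure of the leaf `Σ = {t* = 0} ∩ {r > r₊}` one has `v = r`,
  so `v = r₊` on the sphere `Σ̄ ∩ 𝓗⁺ = {t* = 0, r = r₊}`.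
  (→, clause (i)) The open leaf `Σ = {t* = 0} ∩ {r > r₊}` is not a Cauchy hypersurface of the
  exterior (`KerrData.lean`, "Not a Cauchy hypersurface"), but the exterior FUTURE
  `{t* ≥ 0, r > r₊}` lies in `D⁺(Σ)` (ingoing chart: a past-directed causal curve from the
  exterior cannot reach `𝓗⁺`, and the Euclidean coordinate speed `|dy/dt*|` of a causal curve is
  `≤ 1` as `g = η + 2H ℓ ⊗ ℓ`, `H ≥ 0`; `BlackHoles.lean`, gr.S24),
  so there an admissible `ψ` is determined by its data `(ψ₀, ψ₁) ∈ C_c^∞(Σ)²`. Extending the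
  data by zero across `𝓗⁺`, solving on `{t* ≥ 0, r > m}` (the extended leaf is spacelike,
  `g^{00} = −1 − 2H < 0`) and cutting off by `χ(t*)` (`χ = 0` for `t* ≤ 0`, `χ = 1` for
  `t* ≥ ε`, `ε > 0` small) yields the forward solution `φ = χψ̃` of `□φ = f` with `f = [□, χ]ψ̃`
  smooth and compactly supported in `{r > m}` (finite speed of propagation), i.e. in Hintz's
  forcing class after a translation of his `t_*`; `φ = ψ` on `{t* ≥ ε, r > r₊}`, and Thm. 4.5
  gives the asymptotics below with `c = c(f) = −(2M/π) ∫_{r > r₊} f dvol_g` (the display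
  defining `c(f)` in Thm. 4.5, `= −2Mπ⁻¹⟨f, u*_{(0)}⟩` with `u*_{(0)} = H(r − r₊)`, Lemma 4.4;
  `dvol_g = dt* dy¹ dy² dy³` in Kerr–Schild coordinates, `det g = −1`).
  Nothing is claimed in the PAST of `Σ`: exterior points with `v ≤ r₊` (i.e. `t* ≤ r₊ − r < 0`)
  lie outside `D(Σ) = D⁺(Σ) ∪ D⁻(Σ)` (`t*` decreases along past-directed causal curves, and the
  future-directed ingoing principal null line through such a point keeps `v ≤ r₊`, hence stays in
  `{t* < 0}` while `r > r₊` and leaves the exterior through `𝓗⁺` without meeting `Σ`), and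
  solving the linear characteristic problem TO THE PAST from zero data on the ingoing null
  hypersurface `{v = v₁} ∩ {r ≥ r₊}`, `v₁ < r₊`, and a non-zero bump on `𝓗⁺ ∩ {v < v₁}` yields
  NON-ZERO smooth solutions on the exterior supported in `{v < v₁} ⊂ {t* < 0}`, whose data on
  `Σ ⊂ {v > r₊}` vanish identically — admissible with `K = ∅` and limit `c = 0`; so admissibility
  does not control a wave in the exterior region `t* → −∞` towards `𝓗⁻` and the bifurcation
  sphere (not covered by the ingoing chart), and the trace of an admissible `ψ` on `{t = 0}`
  (along which `v → −∞` at the horizon end) is not shown to be compactly supported.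
  (←, clause (ii)) For `φ₀, φ₁ ∈ C_c^∞((r₊, ∞) × S²)` on
  `{t = 0}` the solution is smooth on the whole exterior (`{t = 0}` is a Cauchy hypersurface of
  the Boyer–Lindquist block); its data on `Σ` are compactly supported in the open leaf PROVIDED
  `v > r₊` on the support (then `(J⁺ ∪ J⁻)(supp) ∩ Σ` is compact: near `𝓗⁺` the leaf has
  `v < min_supp v` and retarded time `u > max_supp u`, near infinity `v > max_supp v` and
  `u < min_supp u`; data closer to the bifurcation sphere may radiate into `Σ` arbitrarily close
  to `𝓗⁺`), and for such data with `φ₀ = 0 ≤ φ₁ ≢ 0` the constant of Cor. 4.7 is non-zero (the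
  weight of `φ₁`, `(r² + a²)²/Δ_r − a² sin²θ > r² + a² − a² ≥ 0` on `r > r₊` as
  `0 < Δ_r < r² + a²` there, is positive). These identifications are argued here, not proved.
* *Time functions.* The printed time functions (AAG's `τ` with `T(τ) = 1`, `τ|_{Σ₀} = 0`; Hintz's
  `t_*`; Boyer–Lindquist `t` on compact `r`-sets) and the Kerr–Schild time `t*` of the prelude
  chart are all of the form `t + f(r, θ)` with `f` bounded on compact subsets of the exterior,
  and `∂_t = ∂_{t*} = Kerr.stationaryField`. Since `(τ + O(1))³/τ³ → 1`, an asymptotic law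
  `ψ = c τ⁻³ + O(τ^{−3−ε})` at fixed spatial position in one of them gives
  `lim_{τ→∞} τ³ ψ(τ, y) = c` along the `∂_{t*}`-line `τ ↦ (τ, y)` of the Kerr–Schild chart
  (`Kerr.atTime x τ`, spatial part `y` of `x` fixed) — with the SAME `c` at every exterior point
  (AAG: `−8 I₀⁽¹⁾[ψ]` on `{r ≤ R}` for every `R`; Hintz: (1.3)/(1.6) and Thm. 4.5 uniformly on
  compact subsets; `t* − t_*` and the Kerr–Schild vs. Hintz azimuth `φ_*` differ by functions of
  `r` alone, constant along each `∂_{t*}`-line). Only this limit form is vendored.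

## References

* Y. Angelopoulos, S. Aretakis, D. Gajic, *Late-time asymptotics for the wave equation on
  spherically symmetric, stationary spacetimes*, Adv. Math. 323 (2018) 529–621
  (arXiv:1612.01566): abstract; §1.1 (pp. 3–5); eq. for `I₀⁽¹⁾[ψ]` (p. 5); Thm. 1 and Rmk. 1.1
  (p. 6); §1.4 Step 3 (p. 9); Thm. 1.1 (p. 11); §2.1–2.2 (pp. 15–16). Pages of the held arXiv copy.
* P. Hintz, *A sharp version of Price's law for wave decay on asymptotically flat spacetimes*,
  Comm. Math. Phys. 389 (2022) 491–542 (arXiv:2004.01664): Thm. 1.1 with (1.4), Thm. 1.2 with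
  (1.6) (§1–§1.1), the sentence "The constant `c` in Theorem 1.2 only vanishes on a codimension 1
  subspace of initial data" (§1.1, after Rmk. 1.6), Thm. 4.5 and Cor. 4.7 (§4.3: Kerr, forcing
  form and Boyer–Lindquist data away from the horizon), Thm. 5.1 and Cor. 5.4 (§5: Schwarzschild
  angular modes).
* P. Hintz, A. Vasy, *The global non-linear stability of the Kerr–de Sitter family of black
  holes*, Acta Math. 220 (2018) 1–206 (arXiv:1606.04014): Thm. 1.1 (p. 3), §1.1 (p. 12),
  Thm. 1.4 (p. 9).
* S. Klainerman, *The black hole stability problem*, C. R. Mécanique 353 (2025) 555–581, §3.5.1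
  (p. 568).
* M. Dafermos, I. Rodnianski, Y. Shlapentokh-Rothman, Ann. of Math. 183 (2016) (arXiv:1402.7034),
  Thm. 3.1, Cor. 3.1.
* J. Luk, S.-J. Oh, *Late time tail of waves on dynamic asymptotically flat spacetimes of odd
  space dimensions*, arXiv:2404.02220, abstract.
* (Audit 2026-08-15.) P. Hintz, *Mode stability and shallow quasinormal modes of Kerr–de Sitter
  black holes away from extremality*, arXiv:2112.14431, abstract (key `Hintz2021KdSModes`);
  P. Hintz, Y. Xie, *Quasinormal modes of small Schwarzschild–de Sitter black holes*, J. Math.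
  Phys. 63 (2022), arXiv:2105.02347, abstract and §4.3, Rmk. 4.3 (key `HintzXie2021`); S. Ma,
  L. Zhang, *Sharp decay for Teukolsky equation in Kerr spacetimes*, CMP 401 (2023),
  arXiv:2111.04489, Thm. 1.1 (key `MaZhang2021`); P. Millet, *Optimal decay for solutions of the
  Teukolsky equation on the Kerr metric for the full subextremal range*, arXiv:2302.06946, Thm. 1.2
  (key `Millet2023`); D. Gajic, C. Warnick, *A model problem for quasinormal ringdown of
  asymptotically flat or extremal black holes*, J. Math. Phys. 61 (2020), arXiv:1910.08481, abstract
  (key `GajicWarnick2019`); D. Häfner, P. Hintz, A. Vasy, *Linear stability of slowly rotating Kerr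
  black holes*, Invent. Math. 223 (2021), arXiv:1906.00860, abstract (key `HafnerHintzVasy2019`);
  S. Klainerman, C. R. Mécanique 353 (2025), §3.5.1, footnotes 43 and 46 (p. 568). Pages of the
  held arXiv texts.
-/

noncomputable section

open Set Filter Topology
open scoped Manifold ContDiff

namespace Literature.Barriers.FinalStateConjecture.Kerr

/-- Moving a point of `E4` along the time axis does not change its Kerr–Schild radius: the
radius `r(a, x)` depends only on the spatial part `(x¹, x², x³)` (Kerr–Schild 1965; Visser,
arXiv:0706.0622, (35)). [cite: arXiv07060622, (35)] -/
theorem radius_ofTimeSpace_spatial (a τ : ℝ) (x : Literature.Geometry.Lorentzian.E4) :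
    Literature.Geometry.Lorentzian.Kerr.radius a (Literature.Geometry.Lorentzian.E4.ofTimeSpace τ (Literature.Geometry.Lorentzian.E4.spatial x)) = Literature.Geometry.Lorentzian.Kerr.radius a x := by
  have h3 : Literature.Geometry.Lorentzian.E4.ofTimeSpace τ (Literature.Geometry.Lorentzian.E4.spatial x) 3 = x 3 :=
    Literature.Geometry.Lorentzian.E4.ofTimeSpace_apply_succ τ (Literature.Geometry.Lorentzian.E4.spatial x) 2
  simp only [Literature.Geometry.Lorentzian.Kerr.radius, Literature.Geometry.Lorentzian.E4.spatialNorm, Literature.Geometry.Lorentzian.E4.spatial_ofTimeSpace, h3]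

/-- **The point at Kerr–Schild time `τ` on the `∂_{t*}`-line through `x`**: the point of the
chart `Kerr.region a r₀` with coordinates `(τ, x¹, x², x³)`, i.e. the image of `x` under the flow
of the stationary Killing field `∂_{t*} = Kerr.stationaryField` for parameter `τ − t*(x)` (it
stays in the chart since `r` is unchanged, `radius_ofTimeSpace_spatial`). Deliberate dot-notation
extension of the prelude namespace `Literature.Lorentz.Kerr`. Dafermos–Rodnianski, arXiv:0811.0354,
§5.1 (the `t*`-translation flow `φ_τ`). [cite: arXiv08110354, §5.1] -/
def atTime (a r₀ : ℝ) (x : Literature.Geometry.Lorentzian.Kerr.region a r₀) (τ : ℝ) : Literature.Geometry.Lorentzian.Kerr.region a r₀ :=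
  ⟨Literature.Geometry.Lorentzian.E4.ofTimeSpace τ (Literature.Geometry.Lorentzian.E4.spatial (x : Literature.Geometry.Lorentzian.E4)), by
    rw [Literature.Geometry.Lorentzian.Kerr.mem_region, radius_ofTimeSpace_spatial]
    exact x.2⟩

/-- Coordinates of `Kerr.atTime`: time `τ`. [folklore] -/
@[simp]
theorem atTime_apply_zero (a r₀ : ℝ) (x : Literature.Geometry.Lorentzian.Kerr.region a r₀) (τ : ℝ) :
    (atTime a r₀ x τ : Literature.Geometry.Lorentzian.E4) 0 = τ :=
  rfl

/-- Coordinates of `Kerr.atTime`: the spatial part is that of `x`. [folklore] -/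
@[simp]
theorem spatial_atTime (a r₀ : ℝ) (x : Literature.Geometry.Lorentzian.Kerr.region a r₀) (τ : ℝ) :
    Literature.Geometry.Lorentzian.E4.spatial (atTime a r₀ x τ : Literature.Geometry.Lorentzian.E4) = Literature.Geometry.Lorentzian.E4.spatial (x : Literature.Geometry.Lorentzian.E4) :=
  Literature.Geometry.Lorentzian.E4.spatial_ofTimeSpace τ _

/-- `Kerr.atTime` preserves the Kerr–Schild radius. [folklore] -/
@[simp]
theorem radius_atTime (a r₀ : ℝ) (x : Literature.Geometry.Lorentzian.Kerr.region a r₀) (τ : ℝ) :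
    Literature.Geometry.Lorentzian.Kerr.radius a (atTime a r₀ x τ : Literature.Geometry.Lorentzian.E4) = Literature.Geometry.Lorentzian.Kerr.radius a (x : Literature.Geometry.Lorentzian.E4) :=
  radius_ofTimeSpace_spatial a τ _

end Literature.Barriers.FinalStateConjecture.Kerr

namespace Literature.Barriers.FinalStateConjecture

open Literature.Geometry.Lorentzian

/-- **Barrier (Price-law tails): on every sub-extremal Kerr exterior, linear waves from
compactly supported data have a late-time limit `τ³ ψ → c` at each fixed spatial position, with
one and the same constant `c` everywhere, and `c ≠ 0` for some (indeed generic) data — so no decay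
statement faster than `τ⁻³`, in particular no exponential decay, holds for generic solutions.**
Hintz, Comm. Math. Phys. 389 (2022), Thm. 1.2 (Price's law with leading order term on
subextremal Kerr spacetimes): "Let `g` be a subextremal Kerr metric. Consider compactly supported
initial data `φ₀, φ₁ ∈ C_c^∞(X°)`. Then, for a constant `c`, explicitly computable in terms of
`φ₀, φ₁`, the solution `φ` of the initial value problem `□_g φ = 0`, `φ|_{t_*=0} = φ₀`,
`∂_{t_*}φ|_{t_*=0} = φ₁`, decays according to
`|φ − c (t_* + r)/(t_*² (t_* + 2r)²)| ≤ C t_*^{−4+ε} (…)`" (1.6), together with all derivatives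
along `t_* ∂_{t_*}`, rotations and `r∂_r`; and p. 3: "The constant `c` in Theorem 1.2 only
vanishes on a codimension 1 subspace of initial data. Thus, the restriction of `|∂_{t_*}φ|²` to
the event horizon of the black hole generically obeys a pointwise lower (and upper) bound of
`t_*⁻⁶`." For Schwarzschild, Thm. 1.1 (1): for `φ₀, φ₁ ∈ C_c^∞((2m, ∞) × S²)` "There exists a
constant `c ∈ ℂ` so that `φ(t, x)` decays according to `|φ(t, x) − c t⁻³| ≤ C t^{−4+ε}`" on compact
`x`-sets, `c` explicit (1.4); and Angelopoulos–Aretakis–Gajic, Adv. Math. 323 (2018), Thm. 1.1: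
on the spherically symmetric stationary class of §2.1 (Schwarzschild and sub-extremal
Reissner–Nordström included), for data with vanishing Newman–Penrose constant (in particular
compactly supported data), `|ψ(τ, r) + 8 I₀⁽¹⁾[ψ] (τ+1)⁻³| ≤ C(…)(τ+1)^{−3−ε}` on `{r ≤ R}`, where
the time-inverted Newman–Penrose constant `I₀⁽¹⁾[ψ]` "is non-zero for generic smooth compactly
supported initial data" (§1.4, Step 3, p. 9; explicit expression p. 5) — "a complete
characterization of all solutions to the wave equation which satisfy Price's polynomial law `τ⁻³`
as a lower bound" (Thm. 1 and sequel, p. 6).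

**Vendored form** (limit form; module docstring for the rendering): for `|a| < M` (whence
`M > 0`), (i) every admissible wave `ψ` (`Literature.Geometry.Lorentzian.IsAdmissibleKerrWave`) has a constant `c ∈ ℝ`
with `τ³ ψ(τ, y) → c` as `τ → ∞` along the `∂_{t*}`-line through every point `x = (t*, y)` of the
exterior chart (`Kerr.atTime x τ`), and (ii) some admissible wave has such a limit `c ≠ 0`.

BARRIER (D-0021; every clause is a quotation or close paraphrase of the cited locus):
* technique_class: kerr-stability, exponential-decay, spectral-gap, resonance-expansion, Kerr-de-Sitter-transfer, Lambda-to-zero-limit, superpolynomial-rates, integrable-pointwise-decay, compactification-in-exp(-t)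
* blocks: (1) any strengthening of clause (ii) of the final state conjecture (`Literature.Geometry.Lorentzian.Development.SettlesToKerrFamily`: `C^k` convergence to Kerr, no rate) to exponential or super-polynomial convergence rates, and any technique whose output or bootstrap assumption is such a rate, already for the linear scalar model on exactly Schwarzschild or sub-extremal Kerr: generic solutions from compactly supported data equal `c t⁻³ + O(t^{−4+})`, `c ≠ 0` off a codimension-1 subspace of data [cite: Hintz2021, Thms. 1.1–1.2 and p. 3] [cite: AngelopoulosAretakisGajic2018, Thm. 1.1 and §1.4 Step 3]; "all spherically symmetric solutions to the wave equation which decay faster than any polynomial rate (eg. exponentially decaying solutions) satisfy `I₀⁽ʲ⁾[ψ] = 0` for all `j ∈ ℕ`" [cite: AngelopoulosAretakisGajic2018, Rmk. 1.1]; (2) direct transfer to `Λ = 0` of the proof of nonlinear stability of slowly rotating Kerr–de Sitter, whose conclusion and linear theory are exponential decay `g − g_b = O(e^{−α t_*})` to the final metric [cite: HintzVasy2018, Thm. 1.1 (p. 3) and Thm. 1.4 (p. 9)]: "The main simplification in the case of stationary solutions of (14) is that the expected decay rates of perturbations near Kerr–de Sitter is exponential, while in the case `Λ = 0` the decay is lower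 degree polynomial, with various components of tensorial quantities decaying at different rates, and the slowest decaying rate being no better than `t⁻¹`" [cite: Klainerman2025, §3.5.1 (p. 568)].
* because: the `t⁻³` leading term is dictated by a conservation law at null infinity — "the leading-order term in the asymptotic expansion is related to the existence of the conserved Newman–Penrose quantities on null infinity" [cite: AngelopoulosAretakisGajic2018, abstract], namely the Newman–Penrose constant of the time integral `ψ⁽¹⁾` (`Tψ⁽¹⁾ = ψ`), which for compactly supported data of `ψ` is an explicit functional of the data, proportional to the mass parameter `M`, "non-zero for generic smooth compactly supported initial data" [cite: AngelopoulosAretakisGajic2018, §1.4 Step 3 (p. 9) and p. 5]; spectrally, it "is a consequence of a partial expansion of the resolvent at `σ = 0`", whose "strongest singularity [...] is `σ² log(σ + i0)`", forced by the long-range `2m/r` term of the metric [cite: Hintz2021, §1 (p. 2) and p. 4] — i.e. there is no spectral gap at zero energy for `Λ = 0`: "The merely polynomial decay rates on asymptotically flat (`Λ = 0`) as compared to the exponential decay rate on asymptotically hyperbolic (`Λ > 0`) spacetimes is a low frequency effect, related to the very delicate behavior of the resolvent near zero energy on asymptotically flat spaces" [cite: HintzVasy2018, §1.1 (p. 12)];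 "despite the fact that, formally, the Einstein vacuum equation is the limit of (14) as `Λ → 0`, the global behavior of the corresponding solutions is radically different" [cite: Klainerman2025, §3.5.1 (p. 568)].
* evasions_known: work with inverse-polynomial decay throughout: uniform boundedness and `τ⁻²` energy decay for linear waves on the full sub-extremal range (vendored `Literature.Geometry.Lorentzian.drsr_wave_boundedness_kerr`, `Literature.Geometry.Lorentzian.drsr_wave_polynomial_decay_kerr`) [cite: DafermosRodnianskiShlapentokhrothman2014, Thm. 3.1 and Cor. 3.1]; the nonlinear stability proofs for Schwarzschild and slowly rotating Kerr are closed with polynomial decay rates [cite: DafermosHolzegelRodnianskiTaylor2021] [cite: KlainermanSzeftel2023] [cite: GiorgiKlainermanSzeftel2022]; for `Λ > 0`, Fang's "composite methods which bridge the gap between the spectral methods of [Hintz–Vasy] and the more conventional vectorfield methods used in the field" [cite: Klainerman2025, §3.5.1 (p. 568)]. No source records a way to obtain faster-than-`t⁻³` decay for generic data.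
* scope_caveats: (a) the formal statement concerns only the LINEAR SCALAR wave equation on a FIXED exact sub-extremal Kerr background; nothing is asserted about the Teukolsky/linearised-gravity system or the Einstein equations, and on dynamical backgrounds or for nonlinear equations "in general there is a correction to the Price law rates" [cite: LukOh2024, abstract] — the inference from the scalar model to clause (ii) is the cited authors' framing [cite: Klainerman2025, §3.5.1] [cite: HintzVasy2018, §1.1 (p. 12)], not a theorem; (b) limit form only: the printed remainders `O(t^{−4+ε})` / `O(τ^{−3−ε})`, the profile `c(t_*+r)/(t_*²(t_*+2r)²)` up to null infinity, the derivative bounds, the explicit formula for `c` and the codimension-1 genericity are not vendored — clause (ii) of the fact asserts only ONE admissible wave with `c ≠ 0`; (c) the data classes (compact support in the open Kerr–Schild leaf `{t* = 0, r > r₊}` versus `C_c^∞` data on `{t_* = 0}`, on `{t = 0}` away from the horizon, or on AAG's `Σ₀`) do NOT coincide — the leaf is not a Cauchy hypersurface of the exterior, and admissible waves may carry radiation in `{t* < 0}` invisible on the leaf — but clause (i) uses only the future development `D⁺` of the leaf (reduction to the forcing form of [cite: Hintz2021, Thm. 4.5]) and clause (ii) only one Boyer–Lindquist datum placed at advanced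 times `v > r₊`, beyond the sphere `Σ̄ ∩ 𝓗⁺` [cite: Hintz2021, Cor. 4.7]; these one-sided reductions and the comparison of the time functions (Kerr–Schild `t*` versus `t_*`, `t`, AAG's `τ`, pairwise differing by functions bounded on compact `r`-sets, immaterial for the limit) are argued in the module docstring, not proved; (d) the barrier constrains RATES only — it does not obstruct asymptotic stability of Kerr with polynomial rates, which is what is proved for `|a| ≪ M` [cite: KlainermanSzeftel2023]; the statement "slowest decaying rate being no better than `t⁻¹`" for tensorial components is Klainerman's report [cite: Klainerman2025, §3.5.1], not vendored.
* status: established — theorems [cite: Hintz2021, Thm. 1.2 and p. 3] [cite: AngelopoulosAretakisGajic2018, Thm. 1.1]. -/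
def PriceLawTail : Prop :=
  ∀ [Kerr.Facts] [Kerr.SliceFacts] (M a : ℝ), Kerr.IsSubextremal M a →
    (∀ ψ : Kerr.exterior M a → ℝ, IsAdmissibleKerrWave M a ψ →
      ∃ c : ℝ, ∀ x : Kerr.exterior M a,
        Tendsto (fun τ : ℝ ↦ τ ^ 3 * ψ (Kerr.atTime a (Kerr.rPlus M a) x τ)) atTop (𝓝 c)) ∧
    (∃ ψ : Kerr.exterior M a → ℝ, IsAdmissibleKerrWave M a ψ ∧
      ∃ c : ℝ, c ≠ 0 ∧ ∀ x : Kerr.exterior M a,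
        Tendsto (fun τ : ℝ ↦ τ ^ 3 * ψ (Kerr.atTime a (Kerr.rPlus M a) x τ)) atTop (𝓝 c))

/-- Under the fact, Price's polynomial law holds **as a lower bound** for some admissible wave on
every sub-extremal Kerr exterior: there are an admissible `ψ` and `c > 0` such that along the
`∂_{t*}`-line through ANY exterior point, `|ψ(τ, y)| ≥ c τ⁻³` for all late `τ` (from
`τ³ψ → c₀ ≠ 0`: eventually `|τ³ ψ| ≥ |c₀|/2`). In particular no bound `|ψ| ≤ C_ψ ρ(τ)` with
`τ³ρ(τ) → 0` (e.g. `ρ = e^{−ατ}`) can hold for all admissible waves. Angelopoulos–Aretakis–Gajic,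
Adv. Math. 323 (2018), Thm. 1 and sequel ("Price's polynomial law `τ⁻³` as a lower bound");
Hintz, CMP 389 (2022), p. 3. [cite: AngelopoulosAretakisGajic2018, Thm. 1] -/
theorem PriceLawTail.exists_lower_bound (h : PriceLawTail) [Kerr.Facts] [Kerr.SliceFacts]
    {M a : ℝ} (hMa : Kerr.IsSubextremal M a) :
    ∃ ψ : Kerr.exterior M a → ℝ, IsAdmissibleKerrWave M a ψ ∧ ∃ c > (0 : ℝ),
      ∀ x : Kerr.exterior M a, ∃ τ₁ : ℝ, ∀ τ : ℝ, τ₁ ≤ τ →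
        c / τ ^ 3 ≤ |ψ (Kerr.atTime a (Kerr.rPlus M a) x τ)| := by
  obtain ⟨-, ψ, hψ, c₀, hc₀, hlim⟩ := h M a hMa
  refine ⟨ψ, hψ, |c₀| / 2, by positivity, fun x ↦ ?_⟩
  -- eventually `|τ³ ψ| ≥ |c₀|/2` and `τ ≥ 1`
  have h1 : ∀ᶠ τ : ℝ in atTop, |c₀| / 2 ≤ |τ ^ 3 * ψ (Kerr.atTime a (Kerr.rPlus M a) x τ)| := by
    have hball : ∀ᶠ τ : ℝ in atTop,
        dist (τ ^ 3 * ψ (Kerr.atTime a (Kerr.rPlus M a) x τ)) c₀ < |c₀| / 2 :=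
      (hlim x) (Metric.ball_mem_nhds c₀ (by positivity))
    filter_upwards [hball] with τ hτ
    rw [Real.dist_eq] at hτ
    have := abs_sub_abs_le_abs_sub c₀ (τ ^ 3 * ψ (Kerr.atTime a (Kerr.rPlus M a) x τ))
    rw [abs_sub_comm] at this
    linarith
  obtain ⟨τ₁, hτ₁⟩ := (h1.and (eventually_ge_atTop 1)).exists_forall_of_atTop
  refine ⟨τ₁, fun τ hτ ↦ ?_⟩
  obtain ⟨hle, hτ1⟩ := hτ₁ τ hτ
  have hτpos : 0 < τ ^ 3 := by positivity
  rw [abs_mul, abs_of_pos hτpos] at hle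
  rw [div_le_iff₀ hτpos, mul_comm]
  exact hle

end Literature.Barriers.FinalStateConjecture

end

/-! ### Barrier audit 2026-08-15 (D-0021): the window the Price-law barrier leaves open

The audit of `PriceLawTail` (refuter, barrier-audit mode) found the formal fact correct and
established — both clauses are Hintz's Thm. 1.2 with the codimension-1 remark (CMP 389 (2022),
p. 3), and `PriceLawTailProofs.lean` derives them in Lean from his Thm. 4.5 and the Cauchy problem —
but its `technique_class:` line broader than what the cited theorems cover. The declarations below
make the two sides formal: under the fact every admissible wave is `O(τ⁻³)` and integrable in
time along stationary worldlines (so "integrable pointwise decay" is NOT obstructed), while no rate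
`ρ` with `τ³ρ(τ) → 0` bounds all admissible waves (so exponential and super-cubic rates ARE).
`PriceLawTail.narrow` states exactly this window, as a THEOREM under `PriceLawTail`, and carries
the corrected BARRIER block.

Review of the split (2026-08-15, D-0026/D-0027). The audit had vendored the window as a separate
named fact `PriceLawTailNarrow`. That `Prop` was a weaker restatement of `PriceLawTail` — proved from
it in one line, with no source or trust base of its own, and not provable before it (both rest on
Hintz's Thm. 4.5, the named fact `Literature.Geometry.Lorentzian.hintz_priceLaw_forcedWave_kerr`)
— so it is merged back: its statement is now the conclusion of `PriceLawTail.narrow`, its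
rate-exclusion lemma is `not_forall_rate_of_exists_lower_bound` (which needs only the lower-bound
clause, an explicit hypothesis) with `PriceLawTail.not_forall_rate`, and this section introduces no
named fact. -/

noncomputable section

open Set Filter Topology MeasureTheory
open scoped Manifold ContDiff

namespace Literature.Barriers.FinalStateConjecture

open Literature.Geometry.Lorentzian

/-- The `∂_{t*}`-line `τ ↦ Kerr.atTime a r₀ x τ` through a chart point is a continuous curve in the
chart (`t ↦ (t, y)` is continuous, `continuous_ofTimeSpace_left` of `KerrTimeDerivative.lean`;
Dafermos–Rodnianski, arXiv:0811.0354, §5.1, the flow `φ_τ`). [folklore] -/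
theorem Kerr.continuous_atTime (a r₀ : ℝ) (x : Kerr.region a r₀) :
    Continuous (Kerr.atTime a r₀ x) :=
  (continuous_ofTimeSpace_left _).subtype_mk _

/-- An admissible Kerr wave is continuous in time along every `∂_{t*}`-line (it is `C^∞` on the
chart; DRSR, arXiv:1402.7034, §4.1). [folklore] -/
theorem continuous_admissibleKerrWave_line [Kerr.Facts] [Kerr.SliceFacts] {M a : ℝ}
    {ψ : Kerr.exterior M a → ℝ} (hψ : IsAdmissibleKerrWave M a ψ) (x : Kerr.exterior M a) :
    Continuous fun τ : ℝ ↦ ψ (Kerr.atTime a (Kerr.rPlus M a) x τ) :=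
  hψ.contMDiff.continuous.comp (Kerr.continuous_atTime a _ x)

/-- **Under the barrier every admissible wave is `O(τ⁻³)` along every `∂_{t*}`-line, uniformly on
`[1, ∞)`**: from clause (i), `τ³ψ(τ, x⃗) → c`, the continuous function `τ ↦ τ³ψ(τ, x⃗)` is
bounded on `[1, ∞)` (eventually by `|c| + 1`, on the compact remainder by continuity). This is the
upper-bound side of Hintz, CMP 389 (2022), Thm. 1.2 (1.6), in the vendored limit form.
[cite: Hintz2021, Thm. 1.2] -/
theorem PriceLawTail.exists_abs_le_div_cube (h : PriceLawTail) [Kerr.Facts] [Kerr.SliceFacts]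
    {M a : ℝ} (hMa : Kerr.IsSubextremal M a) {ψ : Kerr.exterior M a → ℝ}
    (hψ : IsAdmissibleKerrWave M a ψ) (x : Kerr.exterior M a) :
    ∃ C : ℝ, ∀ τ : ℝ, 1 ≤ τ → |ψ (Kerr.atTime a (Kerr.rPlus M a) x τ)| ≤ C / τ ^ 3 := by
  obtain ⟨hlim, -⟩ := h M a hMa
  obtain ⟨c, hc⟩ := hlim ψ hψ
  set g : ℝ → ℝ := fun τ ↦ τ ^ 3 * ψ (Kerr.atTime a (Kerr.rPlus M a) x τ) with hg
  have hgc : Continuous g := (continuous_pow 3).mul (continuous_admissibleKerrWave_line hψ x)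
  -- eventually `|g| ≤ |c| + 1`
  have hev : ∀ᶠ τ in atTop, |g τ| ≤ |c| + 1 := by
    have hball : ∀ᶠ τ in atTop, dist (g τ) c < 1 := (hc x) (Metric.ball_mem_nhds c one_pos)
    filter_upwards [hball] with τ hτ
    rw [Real.dist_eq] at hτ
    have := abs_sub_abs_le_abs_sub (g τ) c
    linarith
  obtain ⟨T, hT⟩ := hev.exists_forall_of_atTop
  -- on the compact part `[1, max T 1]` the continuous `g` is bounded
  obtain ⟨B, hB⟩ := (isCompact_Icc (a := (1 : ℝ)) (b := max T 1)).exists_bound_of_continuousOn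
    hgc.continuousOn
  refine ⟨max B (|c| + 1), fun τ hτ ↦ ?_⟩
  have hτ3 : 0 < τ ^ 3 := by positivity
  have key : |g τ| ≤ max B (|c| + 1) := by
    rcases le_or_gt τ (max T 1) with hle | hlt
    · exact ((Real.norm_eq_abs _).symm.le.trans (hB τ ⟨hτ, hle⟩)).trans (le_max_left _ _)
    · exact (hT τ ((le_max_left _ _).trans hlt.le)).trans (le_max_right _ _)
  rw [le_div_iff₀ hτ3]
  calc |ψ (Kerr.atTime a (Kerr.rPlus M a) x τ)| * τ ^ 3 = |g τ| := by
        rw [hg, abs_mul, abs_of_pos hτ3, mul_comm]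
    _ ≤ max B (|c| + 1) := key

/-- **Under the barrier every admissible wave is Lebesgue-integrable in time on `[0, ∞)` along
every `∂_{t*}`-line** (continuous on `[0, 1]`, `O(τ⁻³)` on `(1, ∞)`, and `∫₁^∞ τ⁻³ dτ = ½ < ∞`):
Price's `τ⁻³` tail is an INTEGRABLE pointwise decay rate — the technique tag
`integrable-pointwise-decay` of `PriceLawTail` is not covered by the barrier, which on the contrary
implies it. Hintz, CMP 389 (2022), Thm. 1.2. [cite: Hintz2021, Thm. 1.2] -/
theorem PriceLawTail.integrableOn_line (h : PriceLawTail) [Kerr.Facts] [Kerr.SliceFacts]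
    {M a : ℝ} (hMa : Kerr.IsSubextremal M a) {ψ : Kerr.exterior M a → ℝ}
    (hψ : IsAdmissibleKerrWave M a ψ) (x : Kerr.exterior M a) :
    IntegrableOn (fun τ : ℝ ↦ ψ (Kerr.atTime a (Kerr.rPlus M a) x τ)) (Ici 0) := by
  obtain ⟨C, hC⟩ := h.exists_abs_le_div_cube hMa hψ x
  have hcont := continuous_admissibleKerrWave_line hψ x
  rw [← Icc_union_Ioi_eq_Ici zero_le_one]
  refine hcont.integrableOn_Icc.union ?_
  have hdom : IntegrableOn (fun τ : ℝ ↦ C * τ ^ (-3 : ℝ)) (Ioi 1) :=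
    (integrableOn_Ioi_rpow_of_lt (by norm_num) one_pos).const_mul C
  refine Integrable.mono' hdom hcont.aestronglyMeasurable ?_
  refine (ae_restrict_iff' measurableSet_Ioi).mpr (Eventually.of_forall fun τ (hτ : 1 < τ) ↦ ?_)
  have hτ0 : 0 < τ := one_pos.trans hτ
  rw [Real.norm_eq_abs, Real.rpow_neg hτ0.le, show (3 : ℝ) = ((3 : ℕ) : ℝ) by norm_num,
    Real.rpow_natCast, ← div_eq_mul_inv]
  exact hC τ hτ.le

/-- `τ³ e^{−ατ} → 0` as `τ → ∞` for `α > 0` (exponentials beat powers; Mathlib's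
`tendsto_rpow_mul_exp_neg_mul_atTop_nhds_zero` with a natural-number power). [folklore] -/
theorem tendsto_pow_three_mul_exp_neg_mul {α : ℝ} (hα : 0 < α) :
    Tendsto (fun τ : ℝ ↦ τ ^ 3 * Real.exp (-(α * τ))) atTop (𝓝 0) := by
  refine (tendsto_rpow_mul_exp_neg_mul_atTop_nhds_zero 3 α hα).congr' (Eventually.of_forall ?_)
  intro τ
  simp only
  rw [show (3 : ℝ) = ((3 : ℕ) : ℝ) by norm_num, Real.rpow_natCast, neg_mul]


/-- **Barrier (Price-law tails) — narrowed form (barrier audit 2026-08-15, D-0021), a theorem under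
`PriceLawTail`: on every sub-extremal Kerr exterior, (a) EVERY admissible linear wave is, along the
`∂_{t*}`-line through every exterior point, Lebesgue-integrable in time on `[0, ∞)` and `O(τ⁻³)` on
`[1, ∞)`, and (b) SOME admissible wave is bounded below there by `c τ⁻³` at all late times, with
one `c > 0` for all lines. The tail is an integrable rate; no faster rate is uniform over
admissible waves.** Proof: (a) is `PriceLawTail.integrableOn_line` with
`PriceLawTail.exists_abs_le_div_cube` (from clause (i) of `PriceLawTail`, `τ³ψ → c`); (b) is
`PriceLawTail.exists_lower_bound` (from clause (ii), `c ≠ 0`). Hence it rests, like `PriceLawTail`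
(derived in `PriceLawTailProofs` from Hintz's Thm. 4.5 and the Cauchy problem), on Hintz, CMP 389
(2022), Thm. 1.2 / Thm. 4.5 with "The constant `c` in Theorem 1.2 only vanishes on a codimension 1
subspace of initial data" (p. 3). It forgets the existence of the limit `c` and keeps the
two-sided `τ⁻³` envelope, which is all the `blocks` clause uses:
`not_forall_rate_of_exists_lower_bound` (clause (b) ALONE excludes every rate `ρ` with
`τ³ρ(τ) → 0` as a bound on all admissible waves, even with wave- and line-dependent constants),
whence `PriceLawTail.not_forall_rate`, specialised in `PriceLawTail.not_forall_exp_rate`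
(`ρ = e^{−ατ}`) and `PriceLawTail.not_forall_rpow_rate` (`ρ = τ^{−(3+ε)}`).

**Why a narrowed block, and why a theorem rather than a second named fact.** The audit confirmed
every quotation of `PriceLawTail` at page level and found no defect in the formal `Prop`; but four
of its nine `technique_class` tags name techniques the `t⁻³` law does not block and which the
literature uses successfully at `Λ = 0` — only their exponential-RATE versions are blocked. For
grading (D-0021) this block supersedes the `technique_class`, `evasions_known` and `scope_caveats`
lines of `PriceLawTail`; `blocks`, `because` and `status` are unchanged in substance. The audit
first vendored the window as a separate named fact `PriceLawTailNarrow`; being a weaker restatement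
of `PriceLawTail` with no trust base of its own (D-0026), it was merged into the present theorem at
review (2026-08-15): same statement, now a conclusion under the hypothesis `PriceLawTail`.

BARRIER (D-0021; narrowed; every clause is a quotation or close paraphrase of the cited locus):
* technique_class: exponential-decay, superpolynomial-rates, spectral-gap-at-zero-energy, discrete-resonance-expansion-with-exponentially-small-remainder, exponential-rate-transfer-from-positive-Lambda (Kerr–de Sitter rates; compactification of time in `e^{−t}`). NOT covered, and removed from `PriceLawTail`'s list: `kerr-stability` as such — asymptotic stability of Kerr with inverse-polynomial rates is proved for `|a| ≪ M` [cite: KlainermanSzeftel2023] and is clause (ii) of the conjecture itself (cf. caveat (d) of `PriceLawTail`); `integrable-pointwise-decay` — the tail is `O(τ⁻³) ∈ L¹(dτ)` (clause (a); `PriceLawTail.integrableOn_line`); `resonance-expansion` as such — the `t⁻³` term IS the leading singularity `σ² log(σ + i0)` of a low-energy resolvent expansion [cite: Hintz2021, §1 (p. 2)], quasinormal frequencies of asymptotically flat black holes can be defined as genuine eigenvalues (of the generator of time translations of a null foliation on a Gevrey-based Hilbert space) forming a discrete set in a region containing `{Re s > −b, |Im s| > K(b)}`, the scattering resolvent being meromorphic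 in a sector `|arg s| < ϑ₀`, `ϑ₀ > 2π/3` — i.e. off the negative real `s`-axis, the branch cut [cite: GajicWarnick2019, abstract] — and the same low-energy resolvent technology on asymptotically flat spaces ("a robust general framework, based on recent advances in microlocal analysis and non-elliptic Fredholm theory", with constraint damping "as in previous work ... on the nonlinear stability of cosmological black holes") yields the linear stability of slowly rotating Kerr "at an inverse polynomial rate" [cite: HafnerHintzVasy2019, abstract] and sharp Teukolsky asymptotics on the full sub-extremal range [cite: Millet2023, Thm. 1.2]; `Lambda-to-zero-limit` as such — the singular limit `ΛM² ↘ 0` is analysed with "careful uniform a priori estimates" with sub-extremal Kerr and de Sitter space as model problems, all Kerr–de Sitter quasinormal modes in any half space `Im σ > −C√Λ` being `0` or `−i√(Λ/3)(n + o(1))`, `n ∈ ℕ` [cite: Hintz2021KdSModes, abstract], and for small Schwarzschild–de Sitter holes the modes converge to the de Sitter modes, whose "accumulation ... along the negative imaginary axis" is "related to the fact that the Schwarzschild resolvent does not extend meromorphically to the complex plane, but at best to the logarithmic cover of `ℂ ∖ i(−∞, 0]`" [cite: HintzXie2021, §4.3, Rmk. 4.3] — what degenerates as `Λ → 0` is the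 RATE (spectral gap `≤ √(Λ/3)(1 + o(1))`), not the method.
* blocks: as `PriceLawTail`: (1) every strengthening of clause (ii) of the final state conjecture (`Literature.Geometry.Lorentzian.Development.SettlesToKerrFamily`) to exponential or super-polynomial convergence rates, and every technique whose output or bootstrap hypothesis is a pointwise rate `ρ(τ)` with `τ³ρ(τ) → 0` valid for all finite-energy compactly supported linear scalar waves on exact sub-extremal Kerr (formal: `not_forall_rate_of_exists_lower_bound`, `PriceLawTail.not_forall_rate`, `PriceLawTail.not_forall_exp_rate`, `PriceLawTail.not_forall_rpow_rate`) [cite: Hintz2021, Thm. 1.2 and p. 3] [cite: AngelopoulosAretakisGajic2018, Thm. 1 and Rmk. 1.1]; (2) transfer to `Λ = 0` of the exponential rate `g − g_b = O(e^{−α t_*})` of the Kerr–de Sitter stability theorem [cite: HintzVasy2018, Thm. 1.1 (p. 3)]: the Kerr–de Sitter spectral gap is at most `√(Λ/3)(1 + o(1))` as `ΛM² ↘ 0` [cite: Hintz2021KdSModes, abstract], so no `Λ`-uniform exponential rate exists.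
* because: unchanged — the `t⁻³` term is dictated by a conservation law at null infinity (time-inverted Newman–Penrose constant), proportional to `M`, "non-zero for generic smooth compactly supported initial data" [cite: AngelopoulosAretakisGajic2018, §1.4 Step 3 (p. 9)], and spectrally by the absence of a gap at zero energy, strongest resolvent singularity `σ² log(σ + i0)` [cite: Hintz2021, §1 (p. 2)]; "a low frequency effect, related to the very delicate behavior of the resolvent near zero energy on asymptotically flat spaces" [cite: HintzVasy2018, §1.1 (p. 12)].
* evasions_known: (e1) inverse-polynomial decay throughout: `τ⁻²` energy decay on the full sub-extremal range [cite: DafermosRodnianskiShlapentokhrothman2014, Cor. 3.1], nonlinear stability of Schwarzschild and of slowly rotating Kerr closed with polynomial rates [cite: DafermosHolzegelRodnianskiTaylor2021] [cite: KlainermanSzeftel2023]; (e2) bootstraps that need only an integrable or `τ^{−1−δ}` pointwise rate, or `∫^∞ |ψ| dτ < ∞` along worldlines — compatible by clause (a); (e3) low-energy resolvent expansions and b-analysis in the compactification of time by `1/t_*` (not `e^{−t}`): near timelike infinity the b-vector fields are spanned by `τ∂_τ = −t_*∂_{t_*}` and spatial derivatives, and the tail exponents appear as orders of a polyhomogeneous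 expansion there — "exponential decay in logarithmic time" [cite: Hintz2021, Thm. 4.5 and its proof] [cite: HafnerHintzVasy2019, abstract]; (e4) quasinormal-mode expansions whose remainder is the branch-cut (tail) contribution rather than an exponentially small term [cite: GajicWarnick2019, abstract]; (e5) singular-perturbation analysis of `ΛM² ↘ 0` transferring RATE-FREE statements (mode stability, Fredholm set-up) between Kerr–de Sitter and Kerr [cite: Hintz2021KdSModes, abstract] [cite: HintzXie2021, abstract].
* scope_caveats: (a)–(d) of `PriceLawTail` stand; in addition: (e) the exponent `3` is that of the scalar field at fixed `r` for generic data — data supported on angular frequencies `≥ l` decay like `t^{−2l−3}` [cite: Hintz2021, Thm. 1.1, part (2)], and for the spin-`±𝔰` Teukolsky scalars (Maxwell `𝔰 = 1`, linearised gravity `𝔰 = 2`) the sharp law at finite radius is `τ^{−2𝔰−3}` (`τ⁻⁷` for gravity), "as both a lower and an upper bounds", on slowly rotating Kerr [cite: MaZhang2021, Thm. 1.1] and, "under an integrated local energy decay estimate", on any sub-extremal Kerr [cite: MaZhang2021, abstract], the leading-order term being obtained on the full sub-extremal range for every half-integer spin in [cite: Millet2023, Thm. 1.2] — so the obstruction to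 exponential rates extends to linearised gravity with exponent `7`, by theorems NOT vendored here; (f) on dynamical backgrounds and for nonlinear equations the tail stays inverse-polynomial but "in general there is a correction to the Price law rates" [cite: LukOh2024, abstract]; (g) the rate "no better than `t⁻¹`" quoted in `PriceLawTail` from [cite: Klainerman2025, §3.5.1 (p. 568)] is the radiative decay of curvature components in the wave zone ("Responsible for carrying gravitational waves at large distances", ibid., footnote 46), not a fixed-`r` tail, and the obstruction that source records against `Λ → 0` is a different one ("To pass to the limit requires one to understand all global in time solutions of (14) with `Λ = 1`, not only those which are small perturbations of Kerr–de Sitter", ibid., footnote 43) — neither is asserted by this barrier; (h) clause (a) concerns `t* ≥ 0` only: admissible waves may carry radiation in the past of the leaf (module docstring), and nothing is claimed as `t* → −∞`.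
* status: established — proved in this file from `PriceLawTail`, itself derived in `PriceLawTailProofs` (`PriceLawTail.of_hintz`) from the named facts `Literature.Geometry.Lorentzian.hintz_priceLaw_forcedWave_kerr` [cite: Hintz2021, Thm. 4.5] and `Literature.Geometry.Lorentzian.KerrSchild.waveCauchyProblem` (the Cauchy problem on Kerr–Schild backgrounds); the printed source of both clauses is [cite: Hintz2021, Thm. 1.2 and p. 3]. -/
theorem PriceLawTail.narrow (h : PriceLawTail) [Kerr.Facts] [Kerr.SliceFacts] {M a : ℝ}
    (hMa : Kerr.IsSubextremal M a) :
    (∀ ψ : Kerr.exterior M a → ℝ, IsAdmissibleKerrWave M a ψ → ∀ x : Kerr.exterior M a,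
      IntegrableOn (fun τ : ℝ ↦ ψ (Kerr.atTime a (Kerr.rPlus M a) x τ)) (Ici 0) ∧
      ∃ C : ℝ, ∀ τ : ℝ, 1 ≤ τ → |ψ (Kerr.atTime a (Kerr.rPlus M a) x τ)| ≤ C / τ ^ 3) ∧
    (∃ ψ : Kerr.exterior M a → ℝ, IsAdmissibleKerrWave M a ψ ∧
      ∃ c > (0 : ℝ), ∀ x : Kerr.exterior M a, ∃ τ₁ : ℝ, ∀ τ : ℝ, τ₁ ≤ τ →
        c / τ ^ 3 ≤ |ψ (Kerr.atTime a (Kerr.rPlus M a) x τ)|) :=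
  ⟨fun _ hψ x ↦ ⟨h.integrableOn_line hMa hψ x, h.exists_abs_le_div_cube hMa hψ x⟩,
    h.exists_lower_bound hMa⟩

/-- **The lower-bound clause alone carries the whole rate-blocking power**: if some admissible
wave is bounded below by `c τ⁻³`, `c > 0`, at late times along every `∂_{t*}`-line, then no rate
function `ρ` with `τ³ρ(τ) → 0` (e.g. `ρ = e^{−ατ}`, `ρ = τ^{−3−ε}`, any super-polynomial rate)
bounds all admissible waves along `∂_{t*}`-lines at late times, even when the constant may depend
on the wave and on the line: that wave beats `C ρ` on every line (`c ≤ C τ³ρ(τ) → 0` contradicts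
`c > 0`; the exterior is non-empty by `Kerr.Facts.isConnected_region`). Angelopoulos–Aretakis–Gajic,
Adv. Math. 323 (2018), Thm. 1 and sequel ("Price's polynomial law `τ⁻³` as a lower bound") and
Rmk. 1.1 ("all spherically symmetric solutions to the wave equation which decay faster than any
polynomial rate (eg. exponentially decaying solutions) satisfy `I₀⁽ʲ⁾[ψ] = 0` for all `j ∈ ℕ`");
Hintz, CMP 389 (2022), p. 3. [cite: AngelopoulosAretakisGajic2018, Thm. 1 and Rmk. 1.1] -/
theorem not_forall_rate_of_exists_lower_bound [Kerr.Facts] [Kerr.SliceFacts] {M a : ℝ}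
    (hlow : ∃ ψ : Kerr.exterior M a → ℝ, IsAdmissibleKerrWave M a ψ ∧
      ∃ c > (0 : ℝ), ∀ x : Kerr.exterior M a, ∃ τ₁ : ℝ, ∀ τ : ℝ, τ₁ ≤ τ →
        c / τ ^ 3 ≤ |ψ (Kerr.atTime a (Kerr.rPlus M a) x τ)|)
    {ρ : ℝ → ℝ} (hρ : Tendsto (fun τ : ℝ ↦ τ ^ 3 * ρ τ) atTop (𝓝 0)) :
    ¬ ∀ ψ : Kerr.exterior M a → ℝ, IsAdmissibleKerrWave M a ψ → ∀ x : Kerr.exterior M a,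
        ∃ C : ℝ, ∀ᶠ τ : ℝ in atTop, |ψ (Kerr.atTime a (Kerr.rPlus M a) x τ)| ≤ C * ρ τ := by
  intro H
  obtain ⟨ψ, hψ, c, hc, hlow⟩ := hlow
  obtain ⟨x₀, hx₀⟩ :=
    (Kerr.Facts.isConnected_region a (Kerr.rPlus M a) : IsConnected _).nonempty
  set x : Kerr.exterior M a := ⟨x₀, hx₀⟩
  obtain ⟨C, hC⟩ := H ψ hψ x
  obtain ⟨τ₁, hτ₁⟩ := hlow x
  have hev : ∀ᶠ τ : ℝ in atTop, c ≤ C * (τ ^ 3 * ρ τ) := by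
    filter_upwards [hC, eventually_ge_atTop τ₁, eventually_gt_atTop (0 : ℝ)] with τ h1 h2 h3
    have hτ3 : 0 < τ ^ 3 := by positivity
    have h4 : c / τ ^ 3 ≤ C * ρ τ := (hτ₁ τ h2).trans h1
    rw [div_le_iff₀ hτ3] at h4
    linarith
  have hlim : Tendsto (fun τ : ℝ ↦ C * (τ ^ 3 * ρ τ)) atTop (𝓝 (C * 0)) := hρ.const_mul C
  have := ge_of_tendsto hlim hev
  rw [mul_zero] at this
  exact absurd this (not_le.mpr hc)

/-- **Under the barrier no rate beyond `τ⁻³` bounds all admissible waves**: for every rate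
function `ρ` with `τ³ρ(τ) → 0` it is not the case that every admissible wave satisfies
`|ψ(τ, x⃗)| ≤ C_{ψ,x⃗} ρ(τ)` at late times along every `∂_{t*}`-line
(`not_forall_rate_of_exists_lower_bound` fed with clause (b) of `PriceLawTail.narrow`). This is
the formal content of `blocks` (1). Hintz, CMP 389 (2022), Thm. 1.2 and p. 3 ("generically obeys
a pointwise lower (and upper) bound"); Angelopoulos–Aretakis–Gajic, Adv. Math. 323 (2018), Thm. 1
and Rmk. 1.1. [cite: Hintz2021, Thm. 1.2 and p. 3] -/
theorem PriceLawTail.not_forall_rate (h : PriceLawTail) [Kerr.Facts] [Kerr.SliceFacts]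
    {M a : ℝ} (hMa : Kerr.IsSubextremal M a) {ρ : ℝ → ℝ}
    (hρ : Tendsto (fun τ : ℝ ↦ τ ^ 3 * ρ τ) atTop (𝓝 0)) :
    ¬ ∀ ψ : Kerr.exterior M a → ℝ, IsAdmissibleKerrWave M a ψ → ∀ x : Kerr.exterior M a,
        ∃ C : ℝ, ∀ᶠ τ : ℝ in atTop, |ψ (Kerr.atTime a (Kerr.rPlus M a) x τ)| ≤ C * ρ τ :=
  not_forall_rate_of_exists_lower_bound (h.narrow hMa).2 hρ

/-- **No exponential rate at `Λ = 0`**: for `α > 0` it is not the case that every admissible wave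
satisfies `|ψ(τ, x⃗)| ≤ C_{ψ,x⃗} e^{−ατ}` at late times along every `∂_{t*}`-line
(`PriceLawTail.not_forall_rate` with `ρ = e^{−ατ}`, `τ³e^{−ατ} → 0`), under `PriceLawTail`.
This is `blocks` (2) in formal dress: the Kerr–de Sitter conclusion `g − g_b = O(e^{−αt_*})`
(Hintz–Vasy, Acta Math. 220 (2018), Thm. 1.1) has no scalar analogue on Kerr; "The merely
polynomial decay rates on asymptotically flat (`Λ = 0`) ... is a low frequency effect" (ibid.,
§1.1, p. 12). [cite: HintzVasy2018, Thm. 1.1 (p. 3) and §1.1 (p. 12)] -/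
theorem PriceLawTail.not_forall_exp_rate (h : PriceLawTail) [Kerr.Facts] [Kerr.SliceFacts]
    {M a : ℝ} (hMa : Kerr.IsSubextremal M a) {α : ℝ} (hα : 0 < α) :
    ¬ ∀ ψ : Kerr.exterior M a → ℝ, IsAdmissibleKerrWave M a ψ → ∀ x : Kerr.exterior M a,
        ∃ C : ℝ, ∀ᶠ τ : ℝ in atTop,
          |ψ (Kerr.atTime a (Kerr.rPlus M a) x τ)| ≤ C * Real.exp (-(α * τ)) :=
  h.not_forall_rate hMa (tendsto_pow_three_mul_exp_neg_mul hα)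

/-- **No super-cubic polynomial rate**: for `ε > 0` it is not the case that every admissible wave
is `O(τ^{−(3+ε)})` at late times along every `∂_{t*}`-line (`PriceLawTail.not_forall_rate` with
`ρ = τ^{−(3+ε)}`, `τ³ · τ^{−(3+ε)} = τ^{−ε} → 0`), under `PriceLawTail`: the exponent `3` of
Price's law cannot be improved uniformly over compactly supported data. Hintz, CMP 389 (2022),
Thm. 1.2 and p. 3 (generic lower bound `t_*⁻⁶` for `|∂_{t_*}φ|²` on the horizon).
[cite: Hintz2021, Thm. 1.2 and p. 3] -/
theorem PriceLawTail.not_forall_rpow_rate (h : PriceLawTail) [Kerr.Facts] [Kerr.SliceFacts]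
    {M a : ℝ} (hMa : Kerr.IsSubextremal M a) {ε : ℝ} (hε : 0 < ε) :
    ¬ ∀ ψ : Kerr.exterior M a → ℝ, IsAdmissibleKerrWave M a ψ → ∀ x : Kerr.exterior M a,
        ∃ C : ℝ, ∀ᶠ τ : ℝ in atTop,
          |ψ (Kerr.atTime a (Kerr.rPlus M a) x τ)| ≤ C * τ ^ (-(3 + ε)) := by
  refine h.not_forall_rate hMa ?_
  have h1 : Tendsto (fun τ : ℝ ↦ τ ^ (-ε)) atTop (𝓝 0) := tendsto_rpow_neg_atTop hε
  refine h1.congr' ?_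
  filter_upwards [eventually_gt_atTop (0 : ℝ)] with τ hτ
  rw [← Real.rpow_natCast τ 3, ← Real.rpow_add hτ]
  congr 1
  push_cast
  ring

end Literature.Barriers.FinalStateConjecture

end
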